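import Summits.QuantumFields.QCD.Theorems.PauliWegnerSeaFMClosureUnquenchedRepairedC2TwoStar

/-!
# Crux `GaussianLinkFrames.FrameFMClosure` (stmt-QuantumFields-17375), line `pad-the-fibre` — proof-side
# definitions: canonical pad regions, bipartite balance, padded cofactor domination

Route-posited objects of the registered skeleton `Cruxes/FrameFMClosure/Lines/pad_the_fibre.lean` (sha 614b49cc…,
§1), copied VERBATIM (definition bodies byte-identical, docstrings kept) so that the registered stub theorems
`stub_paddedDomination : PaddedCofactorDomination` and
`stub_twoStarOfPadded : FibreBandLaw → PaddedCofactorDomination → SideWitness → ∀ N_f, TwoStarBounds N_f` can land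
under `Theorems/` by name and signature (`Cruxes/…` is not importable from `Theorems/`) — exactly the role
`PauliWegnerSeaFMClosureUnquenchedDefs.lean` plays for the sibling crux.  Nothing of the route is restated.
Contents: `starLinks`, `padLinks`, `padFrozen`, `IsPadRegion`, `touched`, `Balanced`, `PaddedCofactorDomination`, and the
proved sanity implication `padded_of_localCofactorDomination : LocalCofactorDomination → PaddedCofactorDomination`
(K1♭ implies the padded statement: stub 1 of this line is WEAKER than stub 1 of `sibling-graft`), registered on the
crux as the anchor of this file.

References: Aizenman–Schenker–Friedrich–Hundertmark, CMP 224 (2001) 219 [AizenmanEtAl2001] (two-star fibres);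
line card `Cruxes/FrameFMClosure/Lines/pad-the-fibre.md` (canonical pad regions, balance; triage r1-1 sharpen 1).
-/

noncomputable section

namespace Summit.QuantumFields.QCD.Theorems.PadTheFibre

open scoped BigOperators
open MeasureTheory Filter
open Literature.MathematicalPhysics.QuantumFieldTheory Literature.MathematicalPhysics.QuantumLattice
  Literature.Probability.LatticeModels
open Summit.QuantumFields.QCD.Theorems.VonMisesCircles

/-! ## §1 Pad vocabulary and padded cofactor domination -/

open Classical in
/-- The star of `x`: the `≤ 8` links with an endpoint at `x` (K1♭'s refit links at one site). -/
def starLinks (S : ℕ) (x : TorusSite 4 (2 * S + 1)) : Finset (Edge 4 (2 * S + 1)) :=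
  Finset.univ.filter fun e : Edge 4 (2 * S + 1) => e.1 = x ∨ e.1.shift e.2 = x

open Classical in
/-- The links of the even `4⁴` pad about `x'`: both endpoints in `ebox S x' 1 = x' + {-2,-1,0,1}⁴` (768 links
when the pad does not wrap). -/
def padLinks (S : ℕ) (x' : TorusSite 4 (2 * S + 1)) : Finset (Edge 4 (2 * S + 1)) :=
  Finset.univ.filter fun e : Edge 4 (2 * S + 1) => e.1 ∈ ebox S x' 1 ∧ e.1.shift e.2 ∈ ebox S x' 1

open Classical in
/-- The FROZEN BOUNDARY LAYERS of the pad about `x'` selected by `(M, c)`: the pad sites `x' + w`,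
`w ∈ {-2,…,1}⁴`, having `w μ = c μ` for some chosen coordinate `μ ∈ M` (the consumer takes `c μ ∈ {-2, 1}`, i.e.
the bottom or the top layer of the pad in direction `μ`; at most one layer per coordinate).  In clause (T1) these
are the layers of the pad lying inside `W = ebox(x,ℓ)` resp. outside `Λ = ebox(x,3ℓ+2)`, whose in-layer links
must stay frozen so that the inside / far factors are constant on the fibre (one layer on the `W` side by
convexity; up to four on the `Λᶜ` side, at the corners of `Λ`). -/
def padFrozen (S : ℕ) (x' : TorusSite 4 (2 * S + 1)) (M : Finset (Fin 4)) (c : Fin 4 → ℤ) :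
    Finset (TorusSite 4 (2 * S + 1)) :=
  ((Fintype.piFinset fun _ : Fin 4 => Finset.Icc (-2 : ℤ) 1).filter fun w => ∃ μ ∈ M, w μ = c μ).image
    fun w => x' + Torus.proj (2 * S + 1) w

open Classical in
/-- **Canonical pad regions** about `x'`: `Q` consists of pad links, contains EVERY pad link with no endpoint in
the frozen layers (the whole interior of the pad is refitted — this is the lever), contains NO in-layer link of
a frozen layer (both endpoints frozen), and is otherwise free on the rungs (links with exactly one frozen
endpoint; the consumer drops a few rungs only to re-balance the touched region at the 16 corners of `Λ`).
`M = ∅` gives exactly the full pad `Q = padLinks S x'`. -/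
def IsPadRegion (S : ℕ) (x' : TorusSite 4 (2 * S + 1)) (Q : Finset (Edge 4 (2 * S + 1))) : Prop :=
  ∃ (M : Finset (Fin 4)) (c : Fin 4 → ℤ), (∀ μ ∈ M, c μ = -2 ∨ c μ = 1) ∧
    ((padLinks S x').filter fun e : Edge 4 (2 * S + 1) =>
        e.1 ∉ padFrozen S x' M c ∧ e.1.shift e.2 ∉ padFrozen S x' M c) ⊆ Q ∧
    Q ⊆ (padLinks S x').filter fun e : Edge 4 (2 * S + 1) =>
        ¬ (e.1 ∈ padFrozen S x' M c ∧ e.1.shift e.2 ∈ padFrozen S x' M c)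

open Classical in
/-- The sites of the side `A` TOUCHED by the refit region `R`: endpoints of links of `R` with both endpoints in
`A` (links leaving `A` are inert in the side matrix `D_A ⊕ 1`).  This is the site set of the effective matrix
pencil of the fibre. -/
def touched (S : ℕ) (A : Finset (TorusSite 4 (2 * S + 1))) (R : Finset (Edge 4 (2 * S + 1))) :
    Finset (TorusSite 4 (2 * S + 1)) :=
  A.filter fun z => ∃ e ∈ R, e.1 ∈ A ∧ e.1.shift e.2 ∈ A ∧ (e.1 = z ∨ e.1.shift e.2 = z)

/-- **Bipartite balance** of a finite site set `X`: every proper two-colouring of the nearest-neighbour graph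
induced on `X` has colour classes of equal size (so each connected component of `X` is balanced; vacuous if `X`
carries an odd cycle, which for pad-sized regions happens only on tori too small to hold a pad).  At the doubler
mass `m₀ = -4` the on-site term of the Wilson operator vanishes and an UNBALANCED effective region carries
`12·|imbalance|` structural zero modes for every link field (triage r1-1 App. B, kit j026101) — the reason the
padded statement is asked on balanced regions only. -/
def Balanced {N : ℕ} (X : Finset (TorusSite 4 N)) : Prop :=
  ∀ χ : TorusSite 4 N → Bool,
    (∀ z ∈ X, ∀ μ : Fin 4, z + Pi.single μ 1 ∈ X → χ z ≠ χ (z + Pi.single μ 1)) →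
      (X.filter fun z => χ z = true).card = (X.filter fun z => χ z = false).card

/-- **Padded cofactor domination** (stub 1 of the line; the repaired statement of triage r1-1 sharpen 1, superseding
the monotone `∀ R ⊇ …` form of `Sketch_ideator1.lean`): ONE constant `C₀` such that for every probe mass
`m₀ ∈ [-9, 1]`, every odd torus, background `U`, admissible side `A`, sites `x, y ∈ A` (diagonal included), every
placement of even pads holding `x` resp. `y` in their `2⁴` CORE (`x ∈ ebox S x' 0 = x' + {-1,0}⁴`), every pair of
canonical pad regions `Q₁, Q₂` about them, IF the touched region of `R = stars ∪ Q₁ ∪ Q₂` inside `A` is balanced,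
THEN along the `R`-fibre over `U` the `(x,y)` adjugate block of the side matrix `D_A ⊕ 1` is dominated by `C₀ ·` (a
value of) `|det (D_A ⊕ 1)|` on the same fibre.  Exterior-uniform, volume-uniform, configuration-wise; no measure. -/
def PaddedCofactorDomination : Prop :=
  ∃ C₀ : ℝ, 0 < C₀ ∧ ∀ (m₀ : ℝ), -9 ≤ m₀ → m₀ ≤ 1 →
    ∀ (S : ℕ) (U : GaugeConfig 4 (2 * S + 1) (Matrix.specialUnitaryGroup (Fin 3) ℂ)) (A : Finset (TorusSite 4 (2 * S + 1))),
      AdmissibleSide S A → ∀ (x y : TorusSite 4 (2 * S + 1)), x ∈ A → y ∈ A →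
      ∀ (x' y' : TorusSite 4 (2 * S + 1)), x ∈ ebox S x' 0 → y ∈ ebox S y' 0 →
      ∀ (Q₁ Q₂ : Finset (Edge 4 (2 * S + 1))), IsPadRegion S x' Q₁ → IsPadRegion S y' Q₂ →
        Balanced (touched S A (starLinks S x ∪ starLinks S y ∪ Q₁ ∪ Q₂)) →
        ∀ W : GaugeConfig 4 (2 * S + 1) (Matrix.specialUnitaryGroup (Fin 3) ℂ), ∃ W' : GaugeConfig 4 (2 * S + 1) (Matrix.specialUnitaryGroup (Fin 3) ℂ),
          blockNorm ((sideMatrix A (wilsonD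
              (fun e => if e ∈ starLinks S x ∪ starLinks S y ∪ Q₁ ∪ Q₂ then W e else U e) m₀)).adjugate) x y ≤
            C₀ * ‖(sideMatrix A (wilsonD
              (fun e => if e ∈ starLinks S x ∪ starLinks S y ∪ Q₁ ∪ Q₂ then W' e else U e) m₀)).det‖

/-- **K1♭ implies padded cofactor domination** (two-star domination is uniform in the exterior, so freezing
`R ∖ stars` into the exterior gives it): stub 1 of this line is WEAKER than stub 1 of `sibling-graft`.  PROVED. -/
theorem padded_of_localCofactorDomination :
    LocalCofactorDomination → PaddedCofactorDomination := by
  rintro ⟨C₀, hC₀, h⟩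
  refine ⟨C₀, hC₀, ?_⟩
  intro m₀ hm₁ hm₂ S U A hA x y hx hy x' y' _ _ Q₁ Q₂ _ _ _ W
  set R : Finset (Edge 4 (2 * S + 1)) := starLinks S x ∪ starLinks S y ∪ Q₁ ∪ Q₂ with hRdef
  -- every star link lies in the region
  have hstar : ∀ e : Edge 4 (2 * S + 1),
      (e.1 = x ∨ e.1.shift e.2 = x ∨ e.1 = y ∨ e.1.shift e.2 = y) → e ∈ R := by
    intro e he
    simp only [hRdef, Finset.mem_union, starLinks, Finset.mem_filter, Finset.mem_univ, true_and]
    rcases he with h1 | h2 | h3 | h4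
    · exact Or.inl (Or.inl (Or.inl (Or.inl h1)))
    · exact Or.inl (Or.inl (Or.inl (Or.inr h2)))
    · exact Or.inl (Or.inl (Or.inr (Or.inl h3)))
    · exact Or.inl (Or.inl (Or.inr (Or.inr h4)))
  -- freeze the whole refit region into the background and apply two-star domination there
  have key := h m₀ hm₁ hm₂ S (fun e => if e ∈ R then W e else U e) A hA x y hx hy
  simp only at key
  obtain ⟨W'', hW''⟩ := key W
  have e1 : (fun e : Edge 4 (2 * S + 1) => if e ∈ R then W e else U e) =
      (fun e : Edge 4 (2 * S + 1) => if (e.1 = x ∨ e.1.shift e.2 = x ∨ e.1 = y ∨ e.1.shift e.2 = y) then W e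
        else (if e ∈ R then W e else U e)) := by
    funext e
    by_cases hs : (e.1 = x ∨ e.1.shift e.2 = x ∨ e.1 = y ∨ e.1.shift e.2 = y)
    · simp only [hs, if_true, hstar e hs]
    · simp only [hs, if_false]
  have e2 : (fun e : Edge 4 (2 * S + 1) => if e ∈ R then
        (if (e.1 = x ∨ e.1.shift e.2 = x ∨ e.1 = y ∨ e.1.shift e.2 = y) then W'' e else W e)
        else U e) =
      (fun e : Edge 4 (2 * S + 1) => if (e.1 = x ∨ e.1.shift e.2 = x ∨ e.1 = y ∨ e.1.shift e.2 = y) then W'' e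
        else (if e ∈ R then W e else U e)) := by
    funext e
    by_cases hs : (e.1 = x ∨ e.1.shift e.2 = x ∨ e.1 = y ∨ e.1.shift e.2 = y)
    · simp only [hs, if_true, hstar e hs]
    · simp only [hs, if_false]
  refine ⟨fun e : Edge 4 (2 * S + 1) =>
    if (e.1 = x ∨ e.1.shift e.2 = x ∨ e.1 = y ∨ e.1.shift e.2 = y) then W'' e else W e, ?_⟩
  dsimp only
  rw [e1, e2]
  exact hW''


/-! ## RESHAPE gen 1 (lead a1, 2026-08-17): padded domination asked on large tori only -/

/-- **Padded cofactor domination on LARGE tori** (`4 ≤ S`): the statement of `PaddedCofactorDomination` restricted to odd tori of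
side `2S+1 ≥ 9`.  Reason for the reshape (worker finding, `Cruxes/FrameFMClosure/…` lead report a1): on the `5⁴` and `7⁴` tori
(`S = 2, 3`) two pads with distinct `0`-coordinates carry a straight five- or seven-cycle, so `Balanced (touched …)` holds VACUOUSLY there
and the unrestricted statement asserts domination on a large PROPER fibre for every exterior — an unprotected semi-dark-exterior
claim foreign to the idea; for `4 ≤ S` a canonical touched region (diameter `≤ 8 < 2S+1`) never wraps, so balance is never vacuous.
The consumer loses nothing: the two-star re-run uses `4 ≤ S` only (`PadTheFibreTwoStar.twoStarBounds_of_placements`), the tori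
`S ≤ 3` being served for free by `PadTheFibreTwoStar.regionDom_small_of_sideWitness` (compactness + `SideWitness`). -/
def PaddedCofactorDominationLarge : Prop :=
  ∃ C₀ : ℝ, 0 < C₀ ∧ ∀ (m₀ : ℝ), -9 ≤ m₀ → m₀ ≤ 1 →
    ∀ (S : ℕ), 4 ≤ S → ∀ (U : GaugeConfig 4 (2 * S + 1) (Matrix.specialUnitaryGroup (Fin 3) ℂ)) (A : Finset (TorusSite 4 (2 * S + 1))),
      AdmissibleSide S A → ∀ (x y : TorusSite 4 (2 * S + 1)), x ∈ A → y ∈ A →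
      ∀ (x' y' : TorusSite 4 (2 * S + 1)), x ∈ ebox S x' 0 → y ∈ ebox S y' 0 →
      ∀ (Q₁ Q₂ : Finset (Edge 4 (2 * S + 1))), IsPadRegion S x' Q₁ → IsPadRegion S y' Q₂ →
        Balanced (touched S A (starLinks S x ∪ starLinks S y ∪ Q₁ ∪ Q₂)) →
        ∀ W : GaugeConfig 4 (2 * S + 1) (Matrix.specialUnitaryGroup (Fin 3) ℂ), ∃ W' : GaugeConfig 4 (2 * S + 1) (Matrix.specialUnitaryGroup (Fin 3) ℂ),
          blockNorm ((sideMatrix A (wilsonD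
              (fun e => if e ∈ starLinks S x ∪ starLinks S y ∪ Q₁ ∪ Q₂ then W e else U e) m₀)).adjugate) x y ≤
            C₀ * ‖(sideMatrix A (wilsonD
              (fun e => if e ∈ starLinks S x ∪ starLinks S y ∪ Q₁ ∪ Q₂ then W' e else U e) m₀)).det‖

/-- The unrestricted statement implies the large-torus one (drop the hypothesis `4 ≤ S`). [folklore] -/
theorem paddedLarge_of_padded : PaddedCofactorDomination → PaddedCofactorDominationLarge := by
  rintro ⟨C₀, hC₀, h⟩
  exact ⟨C₀, hC₀, fun m₀ hm₁ hm₂ S _ U A hA x y hx hy x' y' hx' hy' Q₁ Q₂ hQ₁ hQ₂ hB W =>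
    h m₀ hm₁ hm₂ S U A hA x y hx hy x' y' hx' hy' Q₁ Q₂ hQ₁ hQ₂ hB W⟩

/-- K1♭ implies padded cofactor domination on large tori. [folklore] -/
theorem paddedLarge_of_localCofactorDomination :
    LocalCofactorDomination → PaddedCofactorDominationLarge := fun h =>
  paddedLarge_of_padded (padded_of_localCofactorDomination h)

end Summit.QuantumFields.QCD.Theorems.PadTheFibre

end
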